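import Summits.QuantumFields.YangMills.Theorems.BalabanUVNodesN19TiltPathKingModelLocal
import Summits.QuantumFields.YangMills.Theorems.BalabanUVNodesN19TiltPathTilted

/-!
# BalabanUVNodes ∕ node N19 (NE7 bracket) × N14 (NE1′) — LOCALITY OF N14's BINDER IN KING'S GAUSSIAN MODEL: the tilted means of an observable that sees the field only on
# a site set `X` match between consecutive runs with rate `B·e^{2l₀B}·θ_{K+1}·a·|X|∕γ₀` — `|X|`, NOT the volume `|Tor M|` of p518752's `tiltedMeanMatching_kingFullSpace`

Cell `pub-ymgap`, HUMAN RULING D-0062 (Track A), R134 ACCELERATION seat `pub-ymgap-dag-n19-c` (N19 NE7, strategy s1), generation 14, module 22d; route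
`Summits/QuantumFields/YangMills/Theses/BalabanUVNodes.lean` rev 21 (K3⁵ `SpineGivenEndpointR13SepCoP` = stmt-QuantumFields-20296, `--supports … --as helper`); venue R424
(namespace `Summit.QuantumFields.YangMills.BalabanUVNodes.N19TiltPathTiltedLocal`).  ADDITIVE — imports this seat's module 22c `…N19TiltPathKingModelLocal` (through it 22a-I∕II, 22b:
generic-index Feynman–Hellmann, equipartition, the relative pointwise bound `abs_sub_le_of_relClose`, marginalisation `integral_dressed_eq_marginal`, Schur transfers, `relClose_king`,
`measurable_comp_extend`, `local_read_sumCompl`) and module 19c `…N19TiltPathTilted` (p518752: `measurable_mul_exp_self`, `abs_mul_exp_self_le`, the dictionary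
`tiltedMean_withDensity_eq_div`; through it the spine's `DressedMGFForm.tiltedMean` ∕ `TiltedMeanMatching`) — all CITED; THEOREMS ONLY (0 `def`), modifies nothing.

WHY (door d17 LOCALITY, N14 face).  p518752 landed N14's binder `TiltedMeanMatching` in King's full-space Gaussian model with rate `B·e^{2l₀B}·θ_{K+1}a·|Tor M|∕γ₀` — the volume again,
from the `|φ|²`-majorant of the action difference.  For a LOCAL observable the tilted mean `∫We^{sW}ρ ∕ ∫e^{sW}ρ` is a ratio of two dressed partition functions that marginalise
with the SAME constant (22b §4), so it IS the tilted mean of the `|X|`-dimensional marginal; the relative annealed road for tilted means (§1: the covariance integrand is bounded by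
`ε·B·(φ·Δ_uφ)`, equipartition) pays `B·e^{2|s|B}·ε·|ι|`; at King's letters `ε_K = θ_{K+1}a∕γ₀` (22c `relClose_king`).
* §1 [folklore] `integral_abs_form_mul_le_rel` (relative absolute form moment), ★★ `abs_tiltedRatio_sub_le_of_relClose` (generic ι: `B·e^{2|s|B}·ε·|ι|`).
* §2 [folklore] ★★ `abs_tiltedRatio_sub_le_local` (splitting `e : m ⊕ n ≃ ι`, `W` seeing the `m`-block: `B·e^{2|s|B}·ε·|m|`).
* §3 King's letters: ★★ `abs_tiltedMean_sub_le_kingLocal`, ★★★ **`tiltedMeanMatching_kingLocal`** (N14's binder, one class, no bad class, rate `B·e^{2l₀B}·θ_{K+1}a·|X|∕γ₀`),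
  `summable_eta_kingLocal`.

HONEST FRAMING.  King's `A = 0` scalar MODEL + finite-dimensional Gaussian calculus [folklore]; locality = the model's exact Gaussian marginal, not a cluster expansion; NOT Bałaban's
NE1′∕NE7 (NOT PRINTED as two-run statements for d = 4); nothing of Bałaban's instantiated.  Count-neutral; N14 ∕ N19 NOT discharged; K3⁵ NOT claimed; counts UNMOVED (5∕27).
Everything PROVED (0 `sorry`, 0 named facts, standard axioms).  One finite four-torus programme at fixed ε; NOT ℝ⁴, NOT OS, NOT a mass gap, NOT Clay.
-/

noncomputable section

namespace Summit.QuantumFields.YangMills.BalabanUVNodes.N19TiltPathTiltedLocal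

open MeasureTheory Set Filter Real Matrix Topology
open scoped BigOperators ENNReal
open Literature.MathematicalPhysics.QuantumFieldTheory.Balaban1983to89.QGQInverse (Coercive)
open Literature.MathematicalPhysics.QuantumFieldTheory.Balaban1983to89.B5Prop11Plancherel (Tor)
open Literature.MathematicalPhysics.QuantumFieldTheory.King1986 (aK thetaK)
open Literature.MathematicalPhysics.QuantumFieldTheory.King1986.Torus (effLaplacian aminL)
open Literature.LinearAlgebra.Matrix (dotProduct_self_nonneg_real)
open YMDAG.N18.KingModelDens (kingTheta_nonneg summable_kingRadius)
open YMDAG.N18.KingModelDensTorus (measurable_dotProduct_mulVec)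
open YMDAG.N18.KingModelLargeField (effLaplacian_coercive_unif gamma0_pos)
open Summit.QuantumFields.BalabanUV.T4Continuum.NE1p.DressedMGFForm (tiltedMean TiltedMeanMatching)
open Summit.QuantumFields.YangMills.BalabanUVNodes.N19TiltPathGaussian (exp_mul_mem)
open Summit.QuantumFields.YangMills.BalabanUVNodes.N19TiltPathTilted (measurable_mul_exp_self abs_mul_exp_self_le tiltedMean_withDensity_eq_div)
open Summit.QuantumFields.YangMills.BalabanUVNodes.N19AnnealedGeneric
open Summit.QuantumFields.YangMills.BalabanUVNodes.N19AnnealedRelative (abs_sub_le_of_relClose)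
open Summit.QuantumFields.YangMills.BalabanUVNodes.N19GaussianMarginal
open Summit.QuantumFields.YangMills.BalabanUVNodes.N19TiltPathKingModelLocal (relClose_king measurable_comp_extend local_read_sumCompl)

/-! ## §1 The RELATIVE annealed two-run bound for tilted means on a generic finite index -/
section Relative

variable {ι : Type*} [Fintype ι] [DecidableEq ι]

/-- **THE ABSOLUTE FORM MOMENT UNDER A DRESSED GAUSSIAN, RELATIVE EDITION** [folklore] (∘ equipartition): `Δ` `γ`-coercive (`γ > 0`), `|φ·Dφ| ≤ ε·φ·Δφ` POINTWISE, `0 ≤ g ≤ G` measurable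
⇒ `∫ |φ·Dφ|·e^{−½φ·Δφ}·g dφ ≤ G·ε·|ι|·∫ e^{−½φ·Δφ}dφ` — no `γ` in the constant. -/
theorem integral_abs_form_mul_le_rel {Δ D : Matrix ι ι ℝ} {γ ε G : ℝ} (hγ : 0 < γ) (hε : 0 ≤ ε) (hc : Coercive Δ γ)
    (hD : ∀ φ : ι → ℝ, |φ ⬝ᵥ (D *ᵥ φ)| ≤ ε * (φ ⬝ᵥ (Δ *ᵥ φ))) {g : (ι → ℝ) → ℝ} (hg0 : ∀ φ, 0 ≤ g φ) (hgG : ∀ φ, g φ ≤ G) :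
    ∫ φ : ι → ℝ, |φ ⬝ᵥ (D *ᵥ φ)| * Real.exp (-(φ ⬝ᵥ (Δ *ᵥ φ) / 2)) * g φ
      ≤ G * ε * (Fintype.card ι * ∫ φ : ι → ℝ, Real.exp (-(φ ⬝ᵥ (Δ *ᵥ φ) / 2))) := by
  have hG : 0 ≤ G := (hg0 fun _ => 0).trans (hgG _)
  have hκ : 0 ≤ ∑ x, ∑ y, |Δ x y| := Finset.sum_nonneg fun x _ => Finset.sum_nonneg fun y _ => abs_nonneg _
  have hSρi : Integrable (fun φ : ι → ℝ => φ ⬝ᵥ (Δ *ᵥ φ) * Real.exp (-(φ ⬝ᵥ (Δ *ᵥ φ) / 2))) := by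
    have h := integrable_pathDeriv_integrand hγ hκ hc (abs_quadForm_le Δ) (g := fun _ => (1 : ℝ)) measurable_const (fun _ => le_of_eq abs_one)
    refine (h.const_mul (-2)).congr (Eventually.of_forall fun φ => ?_)
    simp only
    ring
  rw [← integral_quadForm_mul_exp_neg hγ hc, ← integral_const_mul]
  refine integral_mono_of_nonneg (Eventually.of_forall fun φ => mul_nonneg (mul_nonneg (abs_nonneg _) (Real.exp_pos _).le) (hg0 φ))
    (hSρi.const_mul _) (Eventually.of_forall fun φ => ?_)
  have hρ0 : 0 ≤ Real.exp (-(φ ⬝ᵥ (Δ *ᵥ φ) / 2)) := (Real.exp_pos _).le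
  have hS0 : 0 ≤ φ ⬝ᵥ (Δ *ᵥ φ) := (mul_nonneg hγ.le (dotProduct_self_nonneg_real φ)).trans (hc φ)
  simp only
  calc |φ ⬝ᵥ (D *ᵥ φ)| * Real.exp (-(φ ⬝ᵥ (Δ *ᵥ φ) / 2)) * g φ
      ≤ ε * (φ ⬝ᵥ (Δ *ᵥ φ)) * Real.exp (-(φ ⬝ᵥ (Δ *ᵥ φ) / 2)) * G :=
        mul_le_mul (mul_le_mul_of_nonneg_right (hD φ) hρ0) (hgG φ) (hg0 φ) (mul_nonneg (mul_nonneg hε hS0) hρ0)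
    _ = G * ε * (φ ⬝ᵥ (Δ *ᵥ φ) * Real.exp (-(φ ⬝ᵥ (Δ *ᵥ φ) / 2))) := by ring

/-- **★★ THE RELATIVE ANNEALED TWO-RUN BOUND FOR TILTED MEANS** [folklore] (∘ 22a-I §2–§3 + p518752 §2's road).  `Δ_A`, `Δ_B` `γ`-coercive (`γ > 0`) on `ι`, relatively close
(`φ·Δ_Bφ ≤ (1+ε)φ·Δ_Aφ`, `φ·Δ_Aφ ≤ (1+ε)φ·Δ_Bφ`, `ε ≥ 0`), `W` bounded measurable (`|W| ≤ B`).  Then for EVERY tilt `s` the `s`-tilted means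
`m_Y(s) = ∫W e^{sW}e^{−½φ·Δ_Yφ} ∕ ∫e^{sW}e^{−½φ·Δ_Yφ}` satisfy `|m_B(s) − m_A(s)| ≤ B·e^{2|s|B}·ε·|ι|` (p518752: `B·e^{2|s|B}·ϑ·|Tor M|∕γ`).  Road: along the chord the derivative
of `m_u` is a covariance `−½·Cov_{u,s}(φ·Dφ, W)`, bounded by `½·2B·E_{u,s}|φ·Dφ| ≤ B·e^{2|s|B}·ε·E_{u,0}[φ·Δ_uφ] = B·e^{2|s|B}·ε·|ι|`. -/
theorem abs_tiltedRatio_sub_le_of_relClose {ΔA ΔB : Matrix ι ι ℝ} {γ ε B : ℝ} (hγ : 0 < γ) (hε : 0 ≤ ε)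
    (hcA : Coercive ΔA γ) (hcB : Coercive ΔB γ)
    (hAB : ∀ φ : ι → ℝ, φ ⬝ᵥ (ΔB *ᵥ φ) ≤ (1 + ε) * (φ ⬝ᵥ (ΔA *ᵥ φ)))
    (hBA : ∀ φ : ι → ℝ, φ ⬝ᵥ (ΔA *ᵥ φ) ≤ (1 + ε) * (φ ⬝ᵥ (ΔB *ᵥ φ)))
    {W : (ι → ℝ) → ℝ} (hWm : Measurable W) (hWb : ∀ φ, |W φ| ≤ B) (s : ℝ) :
    |(∫ φ : ι → ℝ, Real.exp (-(φ ⬝ᵥ (ΔB *ᵥ φ) / 2)) * (W φ * Real.exp (s * W φ)))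
          / (∫ φ : ι → ℝ, Real.exp (-(φ ⬝ᵥ (ΔB *ᵥ φ) / 2)) * Real.exp (s * W φ))
        - (∫ φ : ι → ℝ, Real.exp (-(φ ⬝ᵥ (ΔA *ᵥ φ) / 2)) * (W φ * Real.exp (s * W φ)))
          / (∫ φ : ι → ℝ, Real.exp (-(φ ⬝ᵥ (ΔA *ᵥ φ) / 2)) * Real.exp (s * W φ))|
      ≤ B * Real.exp (2 * (|s| * B)) * ε * Fintype.card ι := by
  -- the chord and its data
  set D : Matrix ι ι ℝ := ΔB - ΔA with hD
  have hco : ∀ u ∈ Set.Icc (0 : ℝ) 1, Coercive (ΔA + u • D) γ := fun u hu => coercive_chord hcA hcB hu.1 hu.2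
  have hκ : 0 ≤ ∑ x, ∑ y, |D x y| := Finset.sum_nonneg fun x _ => Finset.sum_nonneg fun y _ => abs_nonneg _
  have hq : ∀ φ : ι → ℝ, |φ ⬝ᵥ (D *ᵥ φ)| ≤ (∑ x, ∑ y, |D x y|) * (φ ⬝ᵥ φ) := abs_quadForm_le D
  have hrel : ∀ u ∈ Set.Icc (0 : ℝ) 1, ∀ φ : ι → ℝ, |φ ⬝ᵥ (D *ᵥ φ)| ≤ ε * (φ ⬝ᵥ ((ΔA + u • D) *ᵥ φ)) := by
    intro u hu φ
    rw [hD, dotProduct_sub_mulVec, dotProduct_add_smul_mulVec, dotProduct_sub_mulVec]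
    exact abs_sub_le_of_relClose hε (hAB φ) (hBA φ) hu.1 hu.2
  have hB : 0 ≤ B := (abs_nonneg _).trans (hWb fun _ => 0)
  -- the two weights
  have hgm : Measurable fun φ : ι → ℝ => Real.exp (s * W φ) := Real.measurable_exp.comp (hWm.const_mul s)
  have hgb : ∀ φ : ι → ℝ, |Real.exp (s * W φ)| ≤ Real.exp (|s| * B) := fun φ => by
    rw [Real.abs_exp]
    exact (exp_mul_mem hWb s φ).2
  have hfm : Measurable fun φ : ι → ℝ => W φ * Real.exp (s * W φ) := measurable_mul_exp_self hWm s
  have hfb : ∀ φ : ι → ℝ, |W φ * Real.exp (s * W φ)| ≤ B * Real.exp (|s| * B) := abs_mul_exp_self_le hWb s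
  -- the path objects
  set Z : ℝ → ℝ := fun u => ∫ φ : ι → ℝ, Real.exp (-(φ ⬝ᵥ ((ΔA + u • D) *ᵥ φ) / 2)) * Real.exp (s * W φ) with hZ
  set N : ℝ → ℝ := fun u => ∫ φ : ι → ℝ, Real.exp (-(φ ⬝ᵥ ((ΔA + u • D) *ᵥ φ) / 2)) * (W φ * Real.exp (s * W φ)) with hN
  set Zd : ℝ → ℝ := fun u =>
    ∫ φ : ι → ℝ, -(φ ⬝ᵥ (D *ᵥ φ) / 2) * Real.exp (-(φ ⬝ᵥ ((ΔA + u • D) *ᵥ φ) / 2)) * Real.exp (s * W φ) with hZd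
  set Nd : ℝ → ℝ := fun u =>
    ∫ φ : ι → ℝ, -(φ ⬝ᵥ (D *ᵥ φ) / 2) * Real.exp (-(φ ⬝ᵥ ((ΔA + u • D) *ᵥ φ) / 2)) * (W φ * Real.exp (s * W φ)) with hNd
  have hZpos : ∀ u ∈ Set.Icc (0 : ℝ) 1, 0 < Z u := fun u hu => dressedZ_pos hγ (hco u hu) hWm hWb s
  have hderZ : ∀ u ∈ Set.Ioo (0 : ℝ) 1, HasDerivAt Z (Zd u) u := fun u hu =>
    hasDerivAt_integral_exp_neg_path hγ hκ (Ioo_mem_nhds hu.1 hu.2) (fun v hv => hco v (Set.Ioo_subset_Icc_self hv)) hq hgm hgb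
  have hderN : ∀ u ∈ Set.Ioo (0 : ℝ) 1, HasDerivAt N (Nd u) u := fun u hu =>
    hasDerivAt_integral_exp_neg_path hγ hκ (Ioo_mem_nhds hu.1 hu.2) (fun v hv => hco v (Set.Ioo_subset_Icc_self hv)) hq hfm hfb
  have hcontZ : ContinuousOn Z (Set.Icc (0 : ℝ) 1) := continuousOn_integral_exp_neg_path hγ hco hgm hgb
  have hcontN : ContinuousOn N (Set.Icc (0 : ℝ) 1) := continuousOn_integral_exp_neg_path hγ hco hfm hfb
  have hderiv : ∀ u ∈ Set.Ioo (0 : ℝ) 1, HasDerivAt (fun v => N v / Z v) ((Nd u * Z u - N u * Zd u) / Z u ^ 2) u := fun u hu =>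
    (hderN u hu).div (hderZ u hu) (hZpos u (Set.Ioo_subset_Icc_self hu)).ne'
  have hcont : ContinuousOn (fun v => N v / Z v) (Set.Icc (0 : ℝ) 1) := hcontN.div hcontZ fun u hu => (hZpos u hu).ne'
  -- the COVARIANCE bound on the open chord
  set C : ℝ := B * Real.exp (2 * (|s| * B)) * ε * Fintype.card ι with hC
  have hbound : ∀ u ∈ Set.Ioo (0 : ℝ) 1, |(Nd u * Z u - N u * Zd u) / Z u ^ 2| ≤ C := by
    intro u hu
    have hu' : u ∈ Set.Icc (0 : ℝ) 1 := Set.Ioo_subset_Icc_self hu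
    have hcu : Coercive (ΔA + u • D) γ := hco u hu'
    have hZu : 0 < Z u := hZpos u hu'
    -- integrability
    have hρi := integrable_exp_neg_quadForm hγ hcu
    have hρgi := integrable_dressed hγ hcu hWm hWb s
    have hρfi : Integrable (fun φ : ι → ℝ => Real.exp (-(φ ⬝ᵥ ((ΔA + u • D) *ᵥ φ) / 2)) * (W φ * Real.exp (s * W φ))) :=
      hρi.mul_bdd hfm.aestronglyMeasurable (Eventually.of_forall fun φ => by rw [Real.norm_eq_abs]; exact hfb φ)
    have hqρgi := integrable_pathDeriv_integrand hγ hκ hcu hq hgm hgb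
    have hqρfi := integrable_pathDeriv_integrand hγ hκ hcu hq hfm hfb
    -- the mean `m = N/Z` is bounded by `B`
    set m : ℝ := N u / Z u with hm
    have hNle : |N u| ≤ B * Z u := by
      rw [hZ, ← integral_const_mul]
      refine (abs_integral_le_integral_abs).trans (integral_mono_of_nonneg (Eventually.of_forall fun φ => abs_nonneg _)
        (hρgi.const_mul B) (Eventually.of_forall fun φ => ?_))
      simp only
      rw [abs_mul, abs_mul, Real.abs_exp, Real.abs_exp]
      have h0 : 0 ≤ Real.exp (-(φ ⬝ᵥ ((ΔA + u • D) *ᵥ φ) / 2)) := (Real.exp_pos _).le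
      calc Real.exp (-(φ ⬝ᵥ ((ΔA + u • D) *ᵥ φ) / 2)) * (|W φ| * Real.exp (s * W φ))
          ≤ Real.exp (-(φ ⬝ᵥ ((ΔA + u • D) *ᵥ φ) / 2)) * (B * Real.exp (s * W φ)) :=
            mul_le_mul_of_nonneg_left (mul_le_mul_of_nonneg_right (hWb φ) (Real.exp_pos _).le) h0
        _ = B * (Real.exp (-(φ ⬝ᵥ ((ΔA + u • D) *ᵥ φ) / 2)) * Real.exp (s * W φ)) := by ring
    have hmB : |m| ≤ B := by
      rw [hm, abs_div, abs_of_pos hZu, div_le_iff₀ hZu]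
      exact hNle
    -- `Nd − m·Zd` as ONE integral, and its bound
    have hsplit : Nd u - m * Zd u = ∫ φ : ι → ℝ,
        -(φ ⬝ᵥ (D *ᵥ φ) / 2) * Real.exp (-(φ ⬝ᵥ ((ΔA + u • D) *ᵥ φ) / 2)) * Real.exp (s * W φ) * (W φ - m) := by
      rw [hNd, hZd, ← integral_const_mul, ← integral_sub hqρfi (hqρgi.const_mul m)]
      refine integral_congr_ae (Eventually.of_forall fun φ => ?_)
      simp only
      ring
    have hWm2 : ∀ φ : ι → ℝ, |W φ - m| ≤ 2 * B := fun φ => by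
      have := abs_sub (W φ) m
      linarith [hWb φ, hmB]
    have habsi : Integrable (fun φ : ι → ℝ =>
        |φ ⬝ᵥ (D *ᵥ φ)| * Real.exp (-(φ ⬝ᵥ ((ΔA + u • D) *ᵥ φ) / 2)) * Real.exp (s * W φ)) := by
      refine (hqρgi.norm.const_mul 2).congr (Eventually.of_forall fun φ => ?_)
      simp only
      rw [Real.norm_eq_abs, abs_mul, abs_mul, abs_neg, abs_div, abs_two, Real.abs_exp, Real.abs_exp]
      ring
    have hNdZd : |Nd u - m * Zd u| ≤ B * (Real.exp (|s| * B) * ε *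
        (Fintype.card ι * ∫ φ : ι → ℝ, Real.exp (-(φ ⬝ᵥ ((ΔA + u • D) *ᵥ φ) / 2)))) := by
      rw [hsplit]
      refine (abs_integral_le_integral_abs).trans ?_
      calc ∫ φ : ι → ℝ, |-(φ ⬝ᵥ (D *ᵥ φ) / 2) * Real.exp (-(φ ⬝ᵥ ((ΔA + u • D) *ᵥ φ) / 2)) * Real.exp (s * W φ) * (W φ - m)|
          ≤ ∫ φ : ι → ℝ, B * (|φ ⬝ᵥ (D *ᵥ φ)| * Real.exp (-(φ ⬝ᵥ ((ΔA + u • D) *ᵥ φ) / 2)) * Real.exp (s * W φ)) := by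
            refine integral_mono_of_nonneg (Eventually.of_forall fun φ => abs_nonneg _) (habsi.const_mul B)
              (Eventually.of_forall fun φ => ?_)
            simp only
            rw [abs_mul, abs_mul, abs_mul, abs_neg, abs_div, abs_two, Real.abs_exp, Real.abs_exp]
            have h0 : 0 ≤ |φ ⬝ᵥ (D *ᵥ φ)| / 2 * Real.exp (-(φ ⬝ᵥ ((ΔA + u • D) *ᵥ φ) / 2)) * Real.exp (s * W φ) := by positivity
            calc |φ ⬝ᵥ (D *ᵥ φ)| / 2 * Real.exp (-(φ ⬝ᵥ ((ΔA + u • D) *ᵥ φ) / 2)) * Real.exp (s * W φ) * |W φ - m|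
                ≤ |φ ⬝ᵥ (D *ᵥ φ)| / 2 * Real.exp (-(φ ⬝ᵥ ((ΔA + u • D) *ᵥ φ) / 2)) * Real.exp (s * W φ) * (2 * B) :=
                  mul_le_mul_of_nonneg_left (hWm2 φ) h0
              _ = B * (|φ ⬝ᵥ (D *ᵥ φ)| * Real.exp (-(φ ⬝ᵥ ((ΔA + u • D) *ᵥ φ) / 2)) * Real.exp (s * W φ)) := by ring
        _ = B * ∫ φ : ι → ℝ, |φ ⬝ᵥ (D *ᵥ φ)| * Real.exp (-(φ ⬝ᵥ ((ΔA + u • D) *ᵥ φ) / 2)) * Real.exp (s * W φ) :=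
            integral_const_mul _ _
        _ ≤ B * (Real.exp (|s| * B) * ε * (Fintype.card ι * ∫ φ : ι → ℝ, Real.exp (-(φ ⬝ᵥ ((ΔA + u • D) *ᵥ φ) / 2)))) :=
            mul_le_mul_of_nonneg_left (integral_abs_form_mul_le_rel hγ hε hcu (hrel u hu') (fun φ => (Real.exp_pos _).le)
              (fun φ => (exp_mul_mem hWb s φ).2)) hB
    -- `Z u ≥ e^{−|s|B}·∫ρ`
    have hZlow : Real.exp (-(|s| * B)) * ∫ φ : ι → ℝ, Real.exp (-(φ ⬝ᵥ ((ΔA + u • D) *ᵥ φ) / 2)) ≤ Z u := by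
      rw [hZ, ← integral_const_mul]
      refine integral_mono (hρi.const_mul _) hρgi fun φ => ?_
      simp only
      rw [mul_comm]
      exact mul_le_mul_of_nonneg_left (exp_mul_mem hWb s φ).1 (Real.exp_pos _).le
    -- assemble: |(Nd Z − N Zd)/Z²| = |Nd − m Zd| / Z
    have hrew : (Nd u * Z u - N u * Zd u) / Z u ^ 2 = (Nd u - m * Zd u) / Z u := by
      rw [hm]
      field_simp
    rw [hrew, abs_div, abs_of_pos hZu, div_le_iff₀ hZu]
    refine hNdZd.trans ?_
    have hexp2 : Real.exp (2 * (|s| * B)) = Real.exp (|s| * B) * Real.exp (|s| * B) := by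
      rw [← Real.exp_add]; ring_nf
    have hkey : Real.exp (|s| * B) * ∫ φ : ι → ℝ, Real.exp (-(φ ⬝ᵥ ((ΔA + u • D) *ᵥ φ) / 2)) ≤ Real.exp (2 * (|s| * B)) * Z u := by
      rw [hexp2, mul_assoc]
      refine mul_le_mul_of_nonneg_left ?_ (Real.exp_pos _).le
      have h := mul_le_mul_of_nonneg_left hZlow (Real.exp_pos (|s| * B)).le
      rw [← mul_assoc, ← Real.exp_add, add_neg_cancel, Real.exp_zero, one_mul] at h
      exact h
    have hcard : (0 : ℝ) ≤ Fintype.card ι := Nat.cast_nonneg _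
    calc B * (Real.exp (|s| * B) * ε * (Fintype.card ι * ∫ φ : ι → ℝ, Real.exp (-(φ ⬝ᵥ ((ΔA + u • D) *ᵥ φ) / 2))))
        = B * ε * Fintype.card ι * (Real.exp (|s| * B) * ∫ φ : ι → ℝ, Real.exp (-(φ ⬝ᵥ ((ΔA + u • D) *ᵥ φ) / 2))) := by ring
      _ ≤ B * ε * Fintype.card ι * (Real.exp (2 * (|s| * B)) * Z u) :=
          mul_le_mul_of_nonneg_left hkey (by positivity)
      _ = C * Z u := by rw [hC]; ring
  -- the mean value inequality on `[0,1]`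
  have hdiffOn : DifferentiableOn ℝ (fun v => N v / Z v) (interior (Set.Icc (0 : ℝ) 1)) := by
    rw [interior_Icc]
    exact fun u hu => (hderiv u hu).differentiableAt.differentiableWithinAt
  have hle : ∀ u ∈ interior (Set.Icc (0 : ℝ) 1), deriv (fun v => N v / Z v) u ≤ C := by
    rw [interior_Icc]
    exact fun u hu => by rw [(hderiv u hu).deriv]; exact (abs_le.1 (hbound u hu)).2
  have hge : ∀ u ∈ interior (Set.Icc (0 : ℝ) 1), -C ≤ deriv (fun v => N v / Z v) u := by
    rw [interior_Icc]
    exact fun u hu => by rw [(hderiv u hu).deriv]; exact (abs_le.1 (hbound u hu)).1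
  have h0 : (0 : ℝ) ∈ Set.Icc (0 : ℝ) 1 := ⟨le_rfl, zero_le_one⟩
  have h1 : (1 : ℝ) ∈ Set.Icc (0 : ℝ) 1 := ⟨zero_le_one, le_rfl⟩
  have hup := (convex_Icc (0 : ℝ) 1).image_sub_le_mul_sub_of_deriv_le hcont hdiffOn hle 0 h0 1 h1 zero_le_one
  have hdn := (convex_Icc (0 : ℝ) 1).mul_sub_le_image_sub_of_le_deriv hcont hdiffOn hge 0 h0 1 h1 zero_le_one
  have hZ1 : Z 1 = ∫ φ : ι → ℝ, Real.exp (-(φ ⬝ᵥ (ΔB *ᵥ φ) / 2)) * Real.exp (s * W φ) := by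
    simp only [hZ, hD, one_smul, add_sub_cancel]
  have hN1 : N 1 = ∫ φ : ι → ℝ, Real.exp (-(φ ⬝ᵥ (ΔB *ᵥ φ) / 2)) * (W φ * Real.exp (s * W φ)) := by
    simp only [hN, hD, one_smul, add_sub_cancel]
  have hZ0 : Z 0 = ∫ φ : ι → ℝ, Real.exp (-(φ ⬝ᵥ (ΔA *ᵥ φ) / 2)) * Real.exp (s * W φ) := by
    simp only [hZ, zero_smul, add_zero]
  have hN0 : N 0 = ∫ φ : ι → ℝ, Real.exp (-(φ ⬝ᵥ (ΔA *ᵥ φ) / 2)) * (W φ * Real.exp (s * W φ)) := by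
    simp only [hN, zero_smul, add_zero]
  simp only [hZ1, hN1, hZ0, hN0, sub_zero, mul_one] at hup hdn
  rw [abs_le]
  constructor <;> linarith

end Relative

/-! ## §2 Generic: the tilted-mean two-run bound for a LOCAL observable sees the number of kept sites only -/
section Local

variable {ι m n : Type*} [Fintype ι] [Fintype m] [Fintype n] [DecidableEq m] [DecidableEq n]

/-- **★★ THE LOCAL TILTED-MEAN TWO-RUN BOUND** [folklore] (∘ §1 + module 22b).  `Δ_A`, `Δ_B` `γ`-coercive, `(1+ε)`-sandwiched forms on `ι`; `e : m ⊕ n ≃ ι`; `W` bounded and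
seeing the `m`-block only (`W(v ∘ e⁻¹) = w(v ∘ inl)`, `w` measurable).  Then for every tilt `s` the full-space tilted means satisfy
`|m_B(s) − m_A(s)| ≤ B·e^{2|s|B}·ε·|m|`: numerator and denominator of each tilted mean marginalise with the SAME constant (`integral_mul_eq_marginal` ∕
`integral_dressed_eq_marginal`), which cancels in the ratio; the marginal (Schur) forms are `γ`-coercive and `(1+ε)`-sandwiched; §1 on `m → ℝ`. -/
theorem abs_tiltedRatio_sub_le_local (e : m ⊕ n ≃ ι) {ΔA ΔB : Matrix ι ι ℝ} {γ ε B : ℝ} (hγ : 0 < γ) (hε : 0 ≤ ε)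
    (hcA : Coercive ΔA γ) (hcB : Coercive ΔB γ)
    (hAB : ∀ φ : ι → ℝ, φ ⬝ᵥ (ΔB *ᵥ φ) ≤ (1 + ε) * (φ ⬝ᵥ (ΔA *ᵥ φ)))
    (hBA : ∀ φ : ι → ℝ, φ ⬝ᵥ (ΔA *ᵥ φ) ≤ (1 + ε) * (φ ⬝ᵥ (ΔB *ᵥ φ)))
    {W : (ι → ℝ) → ℝ} (hWb : ∀ φ, |W φ| ≤ B) {w : (m → ℝ) → ℝ} (hwm : Measurable w)
    (hWw : ∀ v : m ⊕ n → ℝ, W (fun a => v (e.symm a)) = w (fun i => v (Sum.inl i))) (s : ℝ) :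
    |(∫ φ : ι → ℝ, Real.exp (-(φ ⬝ᵥ (ΔB *ᵥ φ) / 2)) * (W φ * Real.exp (s * W φ)))
          / (∫ φ : ι → ℝ, Real.exp (-(φ ⬝ᵥ (ΔB *ᵥ φ) / 2)) * Real.exp (s * W φ))
        - (∫ φ : ι → ℝ, Real.exp (-(φ ⬝ᵥ (ΔA *ᵥ φ) / 2)) * (W φ * Real.exp (s * W φ)))
          / (∫ φ : ι → ℝ, Real.exp (-(φ ⬝ᵥ (ΔA *ᵥ φ) / 2)) * Real.exp (s * W φ))|
      ≤ B * Real.exp (2 * (|s| * B)) * ε * Fintype.card m := by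
  -- `w` is bounded like `W`
  have hwb : ∀ x : m → ℝ, |w x| ≤ B := fun x => by
    have h := hWw (Sum.elim x 0)
    simp only [Sum.elim_inl] at h
    rw [← h]
    exact hWb _
  -- the tilted-mean weight, read through the block
  have hWw' : ∀ v : m ⊕ n → ℝ, W (fun a => v (e.symm a)) * Real.exp (s * W (fun a => v (e.symm a)))
      = w (fun i => v (Sum.inl i)) * Real.exp (s * w (fun i => v (Sum.inl i))) := fun v => by rw [hWw]
  have hfm : Measurable fun x : m → ℝ => w x * Real.exp (s * w x) := measurable_mul_exp_self hwm s
  have hfb : ∀ x : m → ℝ, |w x * Real.exp (s * w x)| ≤ B * Real.exp (|s| * B) := abs_mul_exp_self_le hwb s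
  -- symmetrise and relabel
  set ΔA' : Matrix (m ⊕ n) (m ⊕ n) ℝ := ((1 / 2 : ℝ) • (ΔA + ΔAᵀ)).submatrix e e with hΔA'
  set ΔB' : Matrix (m ⊕ n) (m ⊕ n) ℝ := ((1 / 2 : ℝ) • (ΔB + ΔBᵀ)).submatrix e e with hΔB'
  have hsA : ΔA'ᵀ = ΔA' := submatrix_transpose_of_transpose_eq (symmetrize_transpose ΔA) e
  have hsB : ΔB'ᵀ = ΔB' := submatrix_transpose_of_transpose_eq (symmetrize_transpose ΔB) e
  obtain ⟨hblkA, hDA⟩ := eq_fromBlocks_of_transpose_eq hsA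
  obtain ⟨hblkB, hDB⟩ := eq_fromBlocks_of_transpose_eq hsB
  have hqA : ∀ v : m ⊕ n → ℝ, (fun a => v (e.symm a)) ⬝ᵥ (ΔA *ᵥ fun a => v (e.symm a))
      = v ⬝ᵥ (fromBlocks ΔA'.toBlocks₁₁ ΔA'.toBlocks₁₂ ΔA'.toBlocks₁₂ᵀ ΔA'.toBlocks₂₂ *ᵥ v) := fun v => by
    rw [← hblkA, hΔA', ← quadForm_reindex, quadForm_symmetrize]
  have hqB : ∀ v : m ⊕ n → ℝ, (fun a => v (e.symm a)) ⬝ᵥ (ΔB *ᵥ fun a => v (e.symm a))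
      = v ⬝ᵥ (fromBlocks ΔB'.toBlocks₁₁ ΔB'.toBlocks₁₂ ΔB'.toBlocks₁₂ᵀ ΔB'.toBlocks₂₂ *ᵥ v) := fun v => by
    rw [← hblkB, hΔB', ← quadForm_reindex, quadForm_symmetrize]
  have hcA' : Coercive (fromBlocks ΔA'.toBlocks₁₁ ΔA'.toBlocks₁₂ ΔA'.toBlocks₁₂ᵀ ΔA'.toBlocks₂₂) γ := fun v => by
    rw [← hqA, ← dotProduct_self_reindex e v]; exact hcA _
  have hcB' : Coercive (fromBlocks ΔB'.toBlocks₁₁ ΔB'.toBlocks₁₂ ΔB'.toBlocks₁₂ᵀ ΔB'.toBlocks₂₂) γ := fun v => by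
    rw [← hqB, ← dotProduct_self_reindex e v]; exact hcB _
  have hAB' : ∀ v : m ⊕ n → ℝ, v ⬝ᵥ (fromBlocks ΔB'.toBlocks₁₁ ΔB'.toBlocks₁₂ ΔB'.toBlocks₁₂ᵀ ΔB'.toBlocks₂₂ *ᵥ v)
      ≤ (1 + ε) * (v ⬝ᵥ (fromBlocks ΔA'.toBlocks₁₁ ΔA'.toBlocks₁₂ ΔA'.toBlocks₁₂ᵀ ΔA'.toBlocks₂₂ *ᵥ v)) := fun v => by
    rw [← hqA, ← hqB]; exact hAB _
  have hBA' : ∀ v : m ⊕ n → ℝ, v ⬝ᵥ (fromBlocks ΔA'.toBlocks₁₁ ΔA'.toBlocks₁₂ ΔA'.toBlocks₁₂ᵀ ΔA'.toBlocks₂₂ *ᵥ v)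
      ≤ (1 + ε) * (v ⬝ᵥ (fromBlocks ΔB'.toBlocks₁₁ ΔB'.toBlocks₁₂ ΔB'.toBlocks₁₂ᵀ ΔB'.toBlocks₂₂ *ᵥ v)) := fun v => by
    rw [← hqA, ← hqB]; exact hBA _
  have hpdA : ΔA'.toBlocks₂₂.PosDef := posDef_of_coercive hγ (coercive_toBlock₂₂ hcA') hDA
  have hpdB : ΔB'.toBlocks₂₂.PosDef := posDef_of_coercive hγ (coercive_toBlock₂₂ hcB') hDB
  have hSA : Coercive (ΔA'.toBlocks₁₁ - ΔA'.toBlocks₁₂ * (ΔA'.toBlocks₂₂)⁻¹ * ΔA'.toBlocks₁₂ᵀ) γ := coercive_schur hγ.le hpdA hcA'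
  have hSB : Coercive (ΔB'.toBlocks₁₁ - ΔB'.toBlocks₁₂ * (ΔB'.toBlocks₂₂)⁻¹ * ΔB'.toBlocks₁₂ᵀ) γ := coercive_schur hγ.le hpdB hcB'
  have hSAB := schurForm_le_mul hpdA hpdB hAB'
  have hSBA := schurForm_le_mul hpdB hpdA hBA'
  -- marginalisation of numerators and denominators
  have hZA := integral_dressed_eq_marginal e hqA hDA hγ hcA' hWw hwm hwb s
  have hZB := integral_dressed_eq_marginal e hqB hDB hγ hcB' hWw hwm hwb s
  have hNA := integral_mul_eq_marginal e hqA hDA hγ hcA' (Φ := fun φ => W φ * Real.exp (s * W φ)) (F := fun x => w x * Real.exp (s * w x)) hWw' hfm hfb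
  have hNB := integral_mul_eq_marginal e hqB hDB hγ hcB' (Φ := fun φ => W φ * Real.exp (s * W φ)) (F := fun x => w x * Real.exp (s * w x)) hWw' hfm hfb
  have hCA : 0 < ∫ y : n → ℝ, Real.exp (-(y ⬝ᵥ (ΔA'.toBlocks₂₂ *ᵥ y) / 2)) := integral_exp_neg_toBlock₂₂_pos hγ hcA'
  have hCB : 0 < ∫ y : n → ℝ, Real.exp (-(y ⬝ᵥ (ΔB'.toBlocks₂₂ *ᵥ y) / 2)) := integral_exp_neg_toBlock₂₂_pos hγ hcB'
  rw [hZA, hZB, hNA, hNB, mul_div_mul_left _ _ hCB.ne', mul_div_mul_left _ _ hCA.ne']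
  exact abs_tiltedRatio_sub_le_of_relClose hγ hε hSA hSB hSAB hSBA hwm hwb s

end Local

/-! ## §3 King's Gaussian model: N14's binder for a local observable with a volume-free rate -/
section King

variable {d : ℕ} (M : Fin d → ℕ) [hM : ∀ μ, NeZero (M μ)]
variable {l₀ B : ℝ} {W : (Tor M → ℝ) → ℝ}

/-- **★★ THE TILTED-MEAN TWO-RUN BOUND AT KING'S OPERATORS FOR A LOCAL OBSERVABLE** [folklore] (∘ §2 + 22c's `relClose_king`): the `s`-tilted means of a bounded measurable `W`,
LOCAL on `X ⊆ Tor M`, under the full-space effective measures of the runs `Δ^{(K+1)}`, `Δ^{(K+2)}` (as `volume.withDensity e^{−½φ·Δφ}`) differ by at most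
`B·e^{2|s|B}·θ_{K+1}·a·|X|∕γ₀` — p518752's `abs_tiltedMean_sub_le_king` with `|Tor M| ↦ |X|`. [cite: King1986, Prop 3.10 (3.91)–(3.92) p.669; (4.33)–(4.35) p.674] -/
theorem abs_tiltedMean_sub_le_kingLocal {a : ℝ} (ha : 0 < a) {L : ℕ} [NeZero L] (hL : 2 ≤ L) {m2 : ℝ} (hm : 0 < m2) (X : Finset (Tor M)) (hWm : Measurable W)
    (hWb : ∀ φ, |W φ| ≤ B) (hWloc : ∀ φ ψ : Tor M → ℝ, (∀ x ∈ X, φ x = ψ x) → W φ = W ψ) (K : ℕ) (s : ℝ) :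
    |tiltedMean W ((volume : Measure (Tor M → ℝ)).withDensity fun φ => ENNReal.ofReal
          (Real.exp (-(φ ⬝ᵥ (effLaplacian (L ^ (K + 1 + 1)) M (aK a L (K + 1 + 1)) (((L ^ (K + 1 + 1) : ℕ) : ℝ) ^ 2) m2 *ᵥ φ) / 2)))) s
        - tiltedMean W ((volume : Measure (Tor M → ℝ)).withDensity fun φ => ENNReal.ofReal
          (Real.exp (-(φ ⬝ᵥ (effLaplacian (L ^ (K + 1)) M (aK a L (K + 1)) (((L ^ (K + 1) : ℕ) : ℝ) ^ 2) m2 *ᵥ φ) / 2)))) s|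
      ≤ B * Real.exp (2 * (|s| * B)) * (thetaK a L (K + 1) 1 * a) * X.card / ((aminL a L)⁻¹ + m2⁻¹)⁻¹ := by
  have hγ := gamma0_pos ha hL hm
  have hθ : 0 ≤ thetaK a L (K + 1) 1 * a := mul_nonneg (kingTheta_nonneg ha hL (by omega) le_rfl) ha.le
  have hε : 0 ≤ thetaK a L (K + 1) 1 * a / ((aminL a L)⁻¹ + m2⁻¹)⁻¹ := div_nonneg hθ hγ.le
  rw [tiltedMean_withDensity_eq_div M
      (ρ := fun φ => Real.exp (-(φ ⬝ᵥ (effLaplacian (L ^ (K + 1 + 1)) M (aK a L (K + 1 + 1)) (((L ^ (K + 1 + 1) : ℕ) : ℝ) ^ 2) m2 *ᵥ φ) / 2)))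
      (Real.measurable_exp.comp ((measurable_dotProduct_mulVec M _).div_const 2).neg) (fun φ => (Real.exp_pos _).le),
    tiltedMean_withDensity_eq_div M
      (ρ := fun φ => Real.exp (-(φ ⬝ᵥ (effLaplacian (L ^ (K + 1)) M (aK a L (K + 1)) (((L ^ (K + 1) : ℕ) : ℝ) ^ 2) m2 *ᵥ φ) / 2)))
      (Real.measurable_exp.comp ((measurable_dotProduct_mulVec M _).div_const 2).neg) (fun φ => (Real.exp_pos _).le)]
  have h := abs_tiltedRatio_sub_le_local (Equiv.sumCompl fun x => x ∈ X) hγ hε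
    (effLaplacian_coercive_unif M ha hL (k := K + 1) (by omega) hm) (effLaplacian_coercive_unif M ha hL (k := K + 1 + 1) (by omega) hm)
    (fun φ => (relClose_king M ha hL hm K φ).1) (fun φ => (relClose_king M ha hL hm K φ).2) hWb (measurable_comp_extend M X hWm)
    (local_read_sumCompl M X hWloc) s
  rw [Fintype.card_coe] at h
  refine h.trans (le_of_eq ?_)
  field_simp

/-- **★★★ N14's BINDER `TiltedMeanMatching` FOR A LOCAL OBSERVABLE IN KING'S FULL-SPACE GAUSSIAN MODEL, WITH A VOLUME-FREE RATE** [folklore] (∘ `abs_tiltedMean_sub_le_kingLocal`):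
one class (`Unit`), `Bad = ∅`, run A = `volume.withDensity e^{−½φ·Δ^{(K+1)}φ}`, run B = the same for `Δ^{(K+2)}`, the SAME bounded measurable observable `W` LOCAL on `X` read on
both, every source `|t| ≤ l₀` and tilt `|s| ≤ l₀`: `TiltedMeanMatching l₀ univ ∅ W ν_A W ν_B (K ↦ B·e^{2l₀B}·θ_{K+1}·a·|X|∕γ₀)` — p518752's `tiltedMeanMatching_kingFullSpace` with
`|Tor M| ↦ |X|`, uniformly in the torus. -/
theorem tiltedMeanMatching_kingLocal {a : ℝ} (ha : 0 < a) {L : ℕ} [NeZero L] (hL : 2 ≤ L) {m2 : ℝ} (hm : 0 < m2) (X : Finset (Tor M)) (hWm : Measurable W)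
    (hWb : ∀ φ, |W φ| ≤ B) (hWloc : ∀ φ ψ : Tor M → ℝ, (∀ x ∈ X, φ x = ψ x) → W φ = W ψ) :
    TiltedMeanMatching (Ω := fun _ => Tor M → ℝ) (Ω' := fun _ => Tor M → ℝ) l₀ (fun _ => (Finset.univ : Finset Unit)) (fun _ _ => (∅ : Finset Unit))
      (fun _ => W)
      (fun K _ => (volume : Measure (Tor M → ℝ)).withDensity fun φ => ENNReal.ofReal
        (Real.exp (-(φ ⬝ᵥ (effLaplacian (L ^ (K + 1)) M (aK a L (K + 1)) (((L ^ (K + 1) : ℕ) : ℝ) ^ 2) m2 *ᵥ φ) / 2))))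
      (fun _ => W)
      (fun K _ => (volume : Measure (Tor M → ℝ)).withDensity fun φ => ENNReal.ofReal
        (Real.exp (-(φ ⬝ᵥ (effLaplacian (L ^ (K + 1 + 1)) M (aK a L (K + 1 + 1)) (((L ^ (K + 1 + 1) : ℕ) : ℝ) ^ 2) m2 *ᵥ φ) / 2))))
      fun K => B * Real.exp (2 * (l₀ * B)) * (thetaK a L (K + 1) 1 * a) * X.card / ((aminL a L)⁻¹ + m2⁻¹)⁻¹ := by
  intro K t _ τ _ s hs
  have hγ := gamma0_pos ha hL hm
  have hB : 0 ≤ B := (abs_nonneg _).trans (hWb fun _ => 0)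
  have hθ : 0 ≤ thetaK a L (K + 1) 1 * a := mul_nonneg (kingTheta_nonneg ha hL (by omega) le_rfl) ha.le
  have hcard : (0 : ℝ) ≤ X.card := Nat.cast_nonneg _
  have hexp : Real.exp (2 * (|s| * B)) ≤ Real.exp (2 * (l₀ * B)) := Real.exp_le_exp.2 (by nlinarith [abs_nonneg s])
  refine (abs_tiltedMean_sub_le_kingLocal M ha hL hm X hWm hWb hWloc K s).trans ?_
  beta_reduce
  gcongr

omit hM in
/-- … with a SUMMABLE volume-free rate (geometric `θ_{K+1}`, n14-c's `summable_kingRadius`). [folklore] -/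
theorem summable_eta_kingLocal {a : ℝ} (ha : 0 < a) {L : ℕ} (hL : 2 ≤ L) (m2 l₀ B : ℝ) (X : Finset (Tor M)) :
    Summable fun K : ℕ => B * Real.exp (2 * (l₀ * B)) * (thetaK a L (K + 1) 1 * a) * X.card / ((aminL a L)⁻¹ + m2⁻¹)⁻¹ := by
  have h := ((summable_kingRadius ha hL (n := 1) le_rfl (M := (1 : ℝ)) zero_le_one 0).1.mul_left
    (2 * B * Real.exp (2 * (l₀ * B)) * X.card / ((aminL a L)⁻¹ + m2⁻¹)⁻¹))
  refine h.congr fun K => ?_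
  ring

end King

end Summit.QuantumFields.YangMills.BalabanUVNodes.N19TiltPathTiltedLocal

end
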